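/-
Copyright (c) 2026 the pub-hodgecm-mathlib formalisation cell (harness21).  Prover seat hodgecm-mathlib-K2Liu-p13 (g2), Track B «K2-LIT»,
#184♮ = hLiu418 = `stmt-HodgeConjecture-24832`; Road I v3 organ U1-CT-ind STAGE 2 (Q2), file F4-3b (LEAD F0P6-plan (g14) 10:39:33Z ∕ 11:15:51Z «F4 → F5 → D-U1 stage 3 =»;
CENSUS-Q2-F4 `K2/K2Liu-p13/g2/CENSUS-Q2-F4-KlingenUnfold.K2Liu-p13-g2.md` §1 F4-3).
-/
import Summits.HodgeConjecture.HodgeConjecture.Theorems.K2LiuKlingenConstantTermUnfold     -- ★ F4: `mem_compl_cellOne_iff`, `mem_siegelFour_of_toBlocks₂₁_map_eq_zero` (+ ★ F4-1c, F4-1f, F3″)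
import Summits.HodgeConjecture.HodgeConjecture.Theorems.K2LiuKlingenLeviDecomposition      -- ★ F4-3a: `exists_klingenLevi_mul_eq`, `weylXi_conj_*`
import HarnessLib

/-!
# Crux `HLiu418`, Road I v3, organ U1 stage 2 (Q2), file F4-3b: THE `N_Q(L⁺)`-ORBITS OF THE `ξ`-CELL OF `P_Δ(L⁺)\H(L⁺)` —
# `C₁ᶜ = ⋃_{g′ ∈ U(J₂)(L⁺)} O(⟦Ψ(ξ m_Q(1,g′))⟧)`, `O(g′₁) = O(g′₂) ⟺ (g′₂ g′₁⁻¹)₁₀ = 0` (i.e. `B₂ g′₁ = B₂ g′₂`), `Stab(⟦Ψ(ξ m)⟧) = Ψ(m⁻¹ u₊(L⁺) m)`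

Cell `hodgecm-mathlib`, crux item hLiu418 = `stmt-HodgeConjecture-24832`; squad K2 ∕ K2Liu; LEAD F0P6-plan (g14), co-dealer K2E5-plan (g7); prover K2Liu-p13 (g2).
THEOREMS ONLY (no `def`, no instance, no notation, no named-fact hypothesis, no `sorry`); lane `--supports stmt-HodgeConjecture-24832 --as helper` (count-neutral).
`n = 2`; the transport `Ψ` and ★ F3's clauses (T1)(T3)(T4) (+ `XY = YX = a·1`) BY VALUE as section variables.  Rational letters `x ∈ U(J₄)(L⁺)` (B1a at `R := L`, `σ := c`)
are read in `H(L⁺)` as `Ψ(toAdelic x)`; `N_Q(L⁺) := (ratH).subgroupOf (klingenUnipA Ψ)` (★ F4-2a∕b's lattice of ★ F4-1's `N_Q(𝔸)`).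
* §0 `isSiegelDelta_transport_toAdelic_iff` (`Ψ(x) ∈ P_Δ(𝔸) ⟺ x ∈ P(L⁺)`), **`mk_transport_eq_mk_transport_iff`** (`⟦Ψ x⟧ = ⟦Ψ x′⟧ ⟺ x′ x⁻¹ ∈ P(L⁺)`).
* §1 RATIONAL POINTS OF `N_Q(𝔸)`: `transport_toAdelic_nKlingen_eq` (the rational letter `n_Q(y,z,t)`, `y,z,t ∈ L`, read in `H(𝔸)` IS the adelic letter at `(ιy, ιz, ιt)`),
  `transport_toAdelic_mem_klingenUnipA`, and conversely **`exists_mem_klingenUnip_of_mem_ratH`**: a RATIONAL element of `N_Q(𝔸)` is `Ψ(toAdelic n)` with `n ∈ N_Q(L⁺)`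
  (★ F3″ pull-back + ★ F4-1e's eight entry equations, read through the injective `ι : L → 𝔸_L`).
* §2 THE ORBITS: **`exists_levi_unip_of_mem_compl_cellOne`** — every class of the `ξ`-cell is `⟦Ψ(ξ · m_Q(1,g′) n)⟧ = ⟦Ψ(ξ m_Q(1,g′))⟧ · Ψ(n)` (`g′ ∈ U(J₂)(L⁺)`, `n ∈ N_Q(L⁺)`;
  ★ F4-3a Levi decomposition + `ξ m_Q(a,1) ξ⁻¹ ∈ P`); **`apply_one_zero_eq_zero_of_mk_eq_mk`** — `⟦Ψ(ξ m_Q(1,g′₁) n₁)⟧ = ⟦Ψ(ξ m_Q(1,g′₂) n₂)⟧ ⟹ (g′₂ g′₁⁻¹)₁₀ = 0` (the orbit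
  invariant = E1's Borel coset `B₂ g′`, ★ F4-3a §2); **`mk_weylXi_klingenLevi_eq_of_apply_one_zero`** — conversely `(g′₂ g′₁⁻¹)₁₀ = 0 ⟹ ⟦Ψ(ξ m_Q(1,g′₂))⟧ = ⟦Ψ(ξ m_Q(1,g′₁))⟧`.
* §3 THE STABILISERS: **`isSiegelDelta_conj_transport_iff_exists_uPlus`** — for `n ∈ N_Q(L⁺)`, `Ψ(ξ m) Ψ(n) Ψ(ξ m)⁻¹ ∈ P_Δ ⟺ ∃ z, m n m⁻¹ = u_{e₁+e₂}(z)` (`m ∈ Q(L⁺)`;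
  ★ F4-1e `conj_mem_klingenUnip` + ★ F4-0 §3): `Stab(⟦Ψ(ξ m)⟧) = Ψ(m⁻¹ u₊(L⁺) m)` as a membership law — the `Γ'` of ★ F4-2b `tsum_section_eq_integral_wt_smul_subgroup` for F5.
[Xiong2013 §7 L. 7.1], [GanTakeda2011SiegelWeil §7.2 p. 23], [MoeglinWaldspurger1995 I.2.1, II.1.7], [Casselman1980 §3], [KudlaRallis1994 §2].
HONEST LABEL.  Count-neutral helper: `HC_CM` is proved only modulo the 7 printed citations (2 remaining named inputs: hLiu418 = `stmt-HodgeConjecture-24832`,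
h413 = `stmt-HodgeConjecture-24833`) until rung 0 closes.
-/

set_option autoImplicit false
set_option linter.dupNamespace false -- the mandated namespace repeats `HodgeConjecture.HodgeConjecture`

noncomputable section

open scoped Matrix
open NumberField IsDedekindDomain

namespace Summit.HodgeConjecture.HodgeConjecture.Cruxes.HLiu418.K2LiuKlingenCellXiOrbits

open Literature.NumberTheory.Automorphic Literature.NumberTheory.Automorphic.UnitaryGroup
open Literature.NumberTheory.GelbartRogawski1991 Literature.NumberTheory.GelbartRogawski1991.GRConstruction
open Literature.NumberTheory.GaloisRepresentations
open Literature.NumberTheory.K2Lit.SiegelDoubled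
open Summit.HodgeConjecture.HodgeConjecture.Cruxes.HLiu418.K2LiuDoubledUTwoTwoBorelFrame
open Summit.HodgeConjecture.HodgeConjecture.Cruxes.HLiu418.K2LiuKlingenParabolicDefs
open Summit.HodgeConjecture.HodgeConjecture.Cruxes.HLiu418.K2LiuKlingenUnipotentDefs
open Summit.HodgeConjecture.HodgeConjecture.Cruxes.HLiu418.K2LiuKlingenUnipotentAdelicDefs
open Summit.HodgeConjecture.HodgeConjecture.Cruxes.HLiu418.K2LiuKlingenRationalCells
open Summit.HodgeConjecture.HodgeConjecture.Cruxes.HLiu418.K2LiuKlingenUnipotentNormal (mem_klingenUnip_iff_entries conj_mem_klingenUnip)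
open Summit.HodgeConjecture.HodgeConjecture.Cruxes.HLiu418.K2LiuDoubledAntidiagonalTransportRational (isSiegelDelta_transport_iff transport_symm_mem_range)
open Summit.HodgeConjecture.HodgeConjecture.Cruxes.HLiu418.K2LiuSiegelBruhatMiddleCellDelta (mk_eq_mk_iff_isSiegelDelta)
open Summit.HodgeConjecture.HodgeConjecture.Cruxes.HLiu418.K2LiuSiegelDoubledLeviMatrix (conjAdele_conjAdele')
open Summit.HodgeConjecture.HodgeConjecture.Cruxes.HLiu418.K2LiuKlingenConstantTermUnfold (mem_siegelFour_of_toBlocks₂₁_map_eq_zero mem_compl_cellOne_iff)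
open Summit.HodgeConjecture.HodgeConjecture.Cruxes.HLiu418.K2LiuKlingenLeviDecomposition
open UnitaryDualPair

variable {L : Type} [Field L] [NumberField L] [IsCMField L]
variable {N M : ℕ} {e : Fin N × Fin M ≃ Fin 2}
  {dV : Fin N → L} {hdV : ∀ i, IsCMField.complexConj L (dV i) = dV i}
  {dW : Fin M → L} {hdW : ∀ i, IsCMField.complexConj L (dW i) = dW i}

section Transport

variable {SA : GL (Fin (2 + 2)) (AdeleRing (𝓞 L) L)}
  {Ψ : (quasiSplit (Fp L) L (IsCMField.complexConj L) (2 + 2)).Adelic ≃ₜ* HA L e dV hdV dW hdW} {X Y : Matrix (Fin 2) (Fin 2) (Fp L)} {a : Fp L}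
  (hΨ : ∀ g : (quasiSplit (Fp L) L (IsCMField.complexConj L) (2 + 2)).Adelic,
    (((Ψ g : HA L e dV hdV dW hdW) : GL (Fin (2 + 2)) (AdeleRing (𝓞 L) L)) : Matrix (Fin (2 + 2)) (Fin (2 + 2)) (AdeleRing (𝓞 L) L)) =
      (SA : Matrix (Fin (2 + 2)) (Fin (2 + 2)) (AdeleRing (𝓞 L) L)) *
        ((adelicVal (Fp L) L (IsCMField.complexConj L) (2 + 2) _ g : GL (Fin (2 + 2)) (AdeleRing (𝓞 L) L)) :
          Matrix (Fin (2 + 2)) (Fin (2 + 2)) (AdeleRing (𝓞 L) L)) *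
        ((SA⁻¹ : GL (Fin (2 + 2)) (AdeleRing (𝓞 L) L)) : Matrix (Fin (2 + 2)) (Fin (2 + 2)) (AdeleRing (𝓞 L) L)))
  (ha : a + a = 1)
  (hSA : Matrix.reindex (e₂ (n := 2)).symm (e₂ (n := 2)).symm (SA : Matrix (Fin (2 + 2)) (Fin (2 + 2)) (AdeleRing (𝓞 L) L)) =
    Matrix.fromBlocks (1 : Matrix (Fin 2) (Fin 2) (AdeleRing (𝓞 L) L)) (X.map ((algebraMap L (AdeleRing (𝓞 L) L)).comp (algebraMap (Fp L) L))) 1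
      (-(X.map ((algebraMap L (AdeleRing (𝓞 L) L)).comp (algebraMap (Fp L) L)))))
  (hSAi : Matrix.reindex (e₂ (n := 2)).symm (e₂ (n := 2)).symm ((SA⁻¹ : GL (Fin (2 + 2)) (AdeleRing (𝓞 L) L)) : Matrix (Fin (2 + 2)) (Fin (2 + 2)) (AdeleRing (𝓞 L) L)) =
    Matrix.fromBlocks ((a • (1 : Matrix (Fin 2) (Fin 2) (Fp L))).map ((algebraMap L (AdeleRing (𝓞 L) L)).comp (algebraMap (Fp L) L)))
      ((a • (1 : Matrix (Fin 2) (Fin 2) (Fp L))).map ((algebraMap L (AdeleRing (𝓞 L) L)).comp (algebraMap (Fp L) L)))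
      (Y.map ((algebraMap L (AdeleRing (𝓞 L) L)).comp (algebraMap (Fp L) L)))
      (-(Y.map ((algebraMap L (AdeleRing (𝓞 L) L)).comp (algebraMap (Fp L) L)))))
  (hXY : X * Y = a • (1 : Matrix (Fin 2) (Fin 2) (Fp L))) (hYX : Y * X = a • (1 : Matrix (Fin 2) (Fin 2) (Fp L)))

/-! ## §0 Siegel membership and class equality through the transport -/

include hΨ ha hSA hSAi hYX in
/-- **`Ψ(toAdelic x) ∈ P_Δ(𝔸) ⟺ x ∈ P(L⁺)`** for a rational letter `x ∈ U(J₄)(L⁺)` (★ F3″ `isSiegelDelta_transport_iff` + ★ F4 §0 ∕ ★ F4-1c). [cite: HarrisKudlaSweet1996, §1 (1.11)–(1.12)]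
[cite: Xiong2013, §7 Lemma 7.1] -/
theorem isSiegelDelta_transport_toAdelic_iff (x : unitaryGroupOfForm ((IsCMField.complexConj L : L ≃ₐ[Fp L] L) : L →+* L) ((StdForm.antidiagonal 4).over L)) :
    IsSiegelDelta L e dV hdV dW hdW (Ψ (UnitaryGroup.toAdelic (Fp L) L (IsCMField.complexConj L) (2 + 2) ((StdForm.antidiagonal (2 + 2)).over L) x)) ↔
      x ∈ siegelFour L ((IsCMField.complexConj L : L ≃ₐ[Fp L] L) : L →+* L) := by
  rw [isSiegelDelta_transport_iff hΨ ha hSA hSAi hYX, coe_adelicVal_toAdelic L (2 + 2) x]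
  exact ⟨mem_siegelFour_of_toBlocks₂₁_map_eq_zero (NumberField.AdeleRing.algebraMap_injective (𝓞 L) L), toBlocks₂₁_eq_zero_of_mem_siegelFour _⟩

/-- `Ψ ∘ toAdelic` respects inverses on B1a's rational letters (companion of ★ F4-1c `transport_toAdelic_mul`). [cite: Mok2014, §1 Notation p. 5] -/
theorem transport_toAdelic_inv (Ψ : (quasiSplit (Fp L) L (IsCMField.complexConj L) (2 + 2)).Adelic ≃ₜ* HA L e dV hdV dW hdW)
    (x : unitaryGroupOfForm ((IsCMField.complexConj L : L ≃ₐ[Fp L] L) : L →+* L) ((StdForm.antidiagonal 4).over L)) :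
    Ψ (UnitaryGroup.toAdelic (Fp L) L (IsCMField.complexConj L) (2 + 2) ((StdForm.antidiagonal (2 + 2)).over L)
        (x⁻¹ : unitaryGroupOfForm ((IsCMField.complexConj L : L ≃ₐ[Fp L] L) : L →+* L) ((StdForm.antidiagonal 4).over L))) =
      (Ψ (UnitaryGroup.toAdelic (Fp L) L (IsCMField.complexConj L) (2 + 2) ((StdForm.antidiagonal (2 + 2)).over L) x))⁻¹ := by
  have h1 : UnitaryGroup.toAdelic (Fp L) L (IsCMField.complexConj L) (2 + 2) ((StdForm.antidiagonal (2 + 2)).over L)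
        (x⁻¹ : unitaryGroupOfForm ((IsCMField.complexConj L : L ≃ₐ[Fp L] L) : L →+* L) ((StdForm.antidiagonal 4).over L)) =
      (UnitaryGroup.toAdelic (Fp L) L (IsCMField.complexConj L) (2 + 2) ((StdForm.antidiagonal (2 + 2)).over L) x)⁻¹ :=
    map_inv _ _
  rw [h1]
  exact map_inv Ψ _

include hΨ ha hSA hSAi hYX in
/-- **class equality through the transport**: `⟦Ψ(toAdelic x)⟧ = ⟦Ψ(toAdelic x′)⟧` in `P_Δ(L⁺)\H(L⁺)` iff `x′ x⁻¹ ∈ P(L⁺)` (★ B2b `mk_eq_mk_iff_isSiegelDelta` + §0).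
[cite: MoeglinWaldspurger1995, II.1.7] [cite: Xiong2013, §7 Lemma 7.1] -/
theorem mk_transport_eq_mk_transport_iff (x x' : unitaryGroupOfForm ((IsCMField.complexConj L : L ≃ₐ[Fp L] L) : L →+* L) ((StdForm.antidiagonal 4).over L))
    (hx : Ψ (UnitaryGroup.toAdelic (Fp L) L (IsCMField.complexConj L) (2 + 2) ((StdForm.antidiagonal (2 + 2)).over L) x) ∈ ratH L e dV hdV dW hdW)
    (hx' : Ψ (UnitaryGroup.toAdelic (Fp L) L (IsCMField.complexConj L) (2 + 2) ((StdForm.antidiagonal (2 + 2)).over L) x') ∈ ratH L e dV hdV dW hdW) :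
    (Quotient.mk (MulAction.orbitRel (siegelDeltaRat L e dV hdV dW hdW) (ratH L e dV hdV dW hdW)) ⟨_, hx⟩ : SiegelDeltaQuot L e dV hdV dW hdW) =
        Quotient.mk (MulAction.orbitRel (siegelDeltaRat L e dV hdV dW hdW) (ratH L e dV hdV dW hdW)) ⟨_, hx'⟩ ↔
      x' * x⁻¹ ∈ siegelFour L ((IsCMField.complexConj L : L ≃ₐ[Fp L] L) : L →+* L) := by
  rw [mk_eq_mk_iff_isSiegelDelta, ← isSiegelDelta_transport_toAdelic_iff hΨ ha hSA hSAi hYX]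
  have h : ((⟨_, hx'⟩ : ratH L e dV hdV dW hdW) : HA L e dV hdV dW hdW) * (((⟨_, hx⟩ : ratH L e dV hdV dW hdW) : HA L e dV hdV dW hdW))⁻¹ =
      Ψ (UnitaryGroup.toAdelic (Fp L) L (IsCMField.complexConj L) (2 + 2) ((StdForm.antidiagonal (2 + 2)).over L) (x' * x⁻¹)) := by
    rw [transport_toAdelic_mul, transport_toAdelic_inv]
  rw [h]

/-! ## §1 The rational points of `N_Q(𝔸)` are the transported rational letters `Ψ(toAdelic n)`, `n ∈ N_Q(L⁺)` -/

/-- the diagonal embedding of a `c`-skew element of `L` is `(c ⊗ 1)`-skew in `𝔸_L`. [cite: Mok2014, §1 Notation p. 5] -/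
theorem conjAdele_algebraMap_of_skew {y : L} (hy : ((IsCMField.complexConj L : L ≃ₐ[Fp L] L) : L →+* L) y = -y) :
    conjAdele (Fp L) L (IsCMField.complexConj L) (algebraMap L (AdeleRing (𝓞 L) L) y) = -algebraMap L (AdeleRing (𝓞 L) L) y := by
  rw [← algebraMap_conj (Fp L) L (IsCMField.complexConj L) y, hy, map_neg]

/-- **the rational letter `n_Q(y,z,t)` (`y,z,t ∈ L`) read in `U(J₄)(𝔸)` IS the adelic letter `n_Q(ιy, ιz, ιt)`** (entries of ★ `nKlingenM` are polynomial in `y, z, t, σ`;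
`ι ∘ c = (c ⊗ 1) ∘ ι`, ★ `algebraMap_conj`). [cite: Xiong2013, §7 Lemma 7.1] [cite: Mok2014, §1 Notation p. 5] -/
theorem toAdelic_nKlingen_eq_jAdelic (y : L) (hy : ((IsCMField.complexConj L : L ≃ₐ[Fp L] L) : L →+* L) y = -y) (z t : L) :
    UnitaryGroup.toAdelic (Fp L) L (IsCMField.complexConj L) (2 + 2) ((StdForm.antidiagonal (2 + 2)).over L)
        (nKlingen L ((IsCMField.complexConj L : L ≃ₐ[Fp L] L) : L →+* L) (complexConj_ringHom_apply_apply L) y hy z t) =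
      jAdelic L 4 (nKlingen (AdeleRing (𝓞 L) L) (conjAdele (Fp L) L (IsCMField.complexConj L)) (conjAdele_conjAdele' L)
        (algebraMap L (AdeleRing (𝓞 L) L) y) (conjAdele_algebraMap_of_skew hy) (algebraMap L (AdeleRing (𝓞 L) L) z) (algebraMap L (AdeleRing (𝓞 L) L) t)) := by
  refine adelicVal_injective (Fp L) L (IsCMField.complexConj L) (2 + 2) _ (Units.ext ?_)
  rw [coe_adelicVal_toAdelic L (2 + 2), coe_nKlingen, coe_adelicVal_jAdelic_nKlingen]
  ext i j
  fin_cases i <;> fin_cases j <;> simp [nKlingenM]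

/-- **`Ψ(toAdelic n) ∈ N_Q(𝔸)` for `n ∈ N_Q(L⁺)`**. [cite: Xiong2013, §7 Lemma 7.1] -/
theorem transport_toAdelic_mem_klingenUnipA {n : unitaryGroupOfForm ((IsCMField.complexConj L : L ≃ₐ[Fp L] L) : L →+* L) ((StdForm.antidiagonal 4).over L)}
    (hn : n ∈ klingenUnip L ((IsCMField.complexConj L : L ≃ₐ[Fp L] L) : L →+* L) (complexConj_ringHom_apply_apply L)) :
    Ψ (UnitaryGroup.toAdelic (Fp L) L (IsCMField.complexConj L) (2 + 2) ((StdForm.antidiagonal (2 + 2)).over L) n) ∈ klingenUnipA Ψ := by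
  obtain ⟨y, hy, z, t, rfl⟩ := hn
  rw [toAdelic_nKlingen_eq_jAdelic]
  exact transport_nKlingen_mem Ψ _ _ _ _

include hΨ ha hSA hSAi hXY hYX in
/-- **A RATIONAL ELEMENT OF `N_Q(𝔸)` IS A TRANSPORTED RATIONAL LETTER**: `u ∈ N_Q(𝔸) ∩ H(L⁺) ⟹ u = Ψ(toAdelic n)` with `n ∈ N_Q(L⁺)` (`u = Ψ(toAdelic g)` by ★ F3″; the matrix of `g`,
embedded, is an adelic `n_Q`-matrix, so `g` satisfies ★ F4-1e's eight entry equations in `L`, `ι` being injective). [cite: Xiong2013, §7 Lemma 7.1] [cite: MoeglinWaldspurger1995, I.2.1] -/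
theorem exists_mem_klingenUnip_of_mem_ratH {u : HA L e dV hdV dW hdW} (hu : u ∈ klingenUnipA Ψ) (hur : u ∈ ratH L e dV hdV dW hdW) :
    ∃ n ∈ klingenUnip L ((IsCMField.complexConj L : L ≃ₐ[Fp L] L) : L →+* L) (complexConj_ringHom_apply_apply L),
      u = Ψ (UnitaryGroup.toAdelic (Fp L) L (IsCMField.complexConj L) (2 + 2) ((StdForm.antidiagonal (2 + 2)).over L) n) := by
  obtain ⟨g, hg⟩ := transport_symm_mem_range hΨ ha hSA hSAi hXY hYX hur
  have hug : u = Ψ (UnitaryGroup.toAdelic (Fp L) L (IsCMField.complexConj L) (2 + 2) ((StdForm.antidiagonal (2 + 2)).over L) g) := by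
    rw [hg, ContinuousMulEquiv.apply_symm_apply]
  obtain ⟨y, hy, z, t, hu'⟩ := (mem_klingenUnipA_iff Ψ u).1 hu
  refine ⟨g, ?_, hug⟩
  -- the embedded matrix of `g` is the adelic `n_Q(y,z,t)`-matrix
  have hmat : ((g : GL (Fin 4) L) : Matrix (Fin 4) (Fin 4) L).map (algebraMap L (AdeleRing (𝓞 L) L)) =
      nKlingenM (AdeleRing (𝓞 L) L) (conjAdele (Fp L) L (IsCMField.complexConj L)) y z t := by
    have h1 : UnitaryGroup.toAdelic (Fp L) L (IsCMField.complexConj L) (2 + 2) ((StdForm.antidiagonal (2 + 2)).over L) g =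
        jAdelic L 4 (nKlingen (AdeleRing (𝓞 L) L) (conjAdele (Fp L) L (IsCMField.complexConj L)) (conjAdele_conjAdele' L) y hy z t) :=
      Ψ.injective (by rw [← hug, hu'])
    rw [← coe_adelicVal_toAdelic L (2 + 2) g, h1, coe_adelicVal_jAdelic_nKlingen]
  have hι := NumberField.AdeleRing.algebraMap_injective (𝓞 L) L
  have entry : ∀ i j : Fin 4, algebraMap L (AdeleRing (𝓞 L) L) (((g : GL (Fin 4) L) : Matrix (Fin 4) (Fin 4) L) i j) =
      nKlingenM (AdeleRing (𝓞 L) L) (conjAdele (Fp L) L (IsCMField.complexConj L)) y z t i j := fun i j => by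
    rw [← hmat, Matrix.map_apply]
  rw [mem_klingenUnip_iff_entries]
  refine ⟨hι ?_, hι ?_, hι ?_, hι ?_, hι ?_, hι ?_, hι ?_, hι ?_⟩ <;> rw [entry] <;> simp [nKlingenM]

include hΨ ha hSA hSAi hXY hYX in
/-- **membership law of the lattice `N_Q(L⁺) = N_Q(𝔸) ∩ H(L⁺)`**: `u ∈ N_Q(L⁺) ⟺ u = Ψ(toAdelic n)` for some `n ∈ N_Q(L⁺)` (rational letters).
[cite: MoeglinWaldspurger1995, I.2.1] [cite: Xiong2013, §7 Lemma 7.1] -/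
theorem mem_subgroupOf_klingenUnipA_iff (u : ↥(klingenUnipA Ψ)) :
    u ∈ (ratH L e dV hdV dW hdW).subgroupOf (klingenUnipA Ψ) ↔
      ∃ n ∈ klingenUnip L ((IsCMField.complexConj L : L ≃ₐ[Fp L] L) : L →+* L) (complexConj_ringHom_apply_apply L),
        (u : HA L e dV hdV dW hdW) = Ψ (UnitaryGroup.toAdelic (Fp L) L (IsCMField.complexConj L) (2 + 2) ((StdForm.antidiagonal (2 + 2)).over L) n) := by
  rw [Subgroup.mem_subgroupOf]
  refine ⟨fun hur => exists_mem_klingenUnip_of_mem_ratH hΨ ha hSA hSAi hXY hYX u.2 hur, ?_⟩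
  rintro ⟨n, -, hn⟩
  rw [hn]
  exact transport_toAdelic_mem_ratH hΨ ha hSA hSAi hXY hYX n

/-! ## §2 The orbits of the `ξ`-cell: representatives `⟦Ψ(ξ m_Q(1, g′))⟧`, invariant `B₂ g′` -/

include hΨ ha hSA hSAi hXY hYX in
/-- **EVERY CLASS OF THE `ξ`-CELL IS `⟦Ψ(ξ · m_Q(1,g′) · n)⟧`** with `g′ ∈ U(J₂)(L⁺)`, `n ∈ N_Q(L⁺)`: `q = m_Q(a,g′) n` (★ F4-3a) and `ξ m_Q(a,1) ξ⁻¹ ∈ P(L⁺)` is invisible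
(★ F4-3a `weylXi_conj_klingenLevi_one_mem_siegelFour`); so the class lies in the `N_Q(L⁺)`-orbit of `⟦Ψ(ξ m_Q(1,g′))⟧` (★ F4-2b `apply_out_mul_coe_mul` reads it there).
[cite: Xiong2013, §7 Lemma 7.1] [cite: GanTakeda2011SiegelWeil, §7.2 p. 23] [cite: MoeglinWaldspurger1995, II.1.7] -/
theorem exists_levi_unip_of_mem_compl_cellOne (C₁ : Set (SiegelDeltaQuot L e dV hdV dW hdW))
    (hC₁ : ∀ x, x ∈ C₁ ↔ ∃ q ∈ klingen L ((IsCMField.complexConj L : L ≃ₐ[Fp L] L) : L →+* L), ∃ γ : ratH L e dV hdV dW hdW,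
      (γ : HA L e dV hdV dW hdW) = Ψ (UnitaryGroup.toAdelic (Fp L) L (IsCMField.complexConj L) (2 + 2) ((StdForm.antidiagonal (2 + 2)).over L) q) ∧
        x = Quotient.mk (MulAction.orbitRel (siegelDeltaRat L e dV hdV dW hdW) (ratH L e dV hdV dW hdW)) γ)
    {x : SiegelDeltaQuot L e dV hdV dW hdW} (hx : x ∈ C₁ᶜ) :
    ∃ (g : unitaryGroupOfForm ((IsCMField.complexConj L : L ≃ₐ[Fp L] L) : L →+* L) ((StdForm.antidiagonal 2).over L))
      (n : unitaryGroupOfForm ((IsCMField.complexConj L : L ≃ₐ[Fp L] L) : L →+* L) ((StdForm.antidiagonal 4).over L)),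
      n ∈ klingenUnip L ((IsCMField.complexConj L : L ≃ₐ[Fp L] L) : L →+* L) (complexConj_ringHom_apply_apply L) ∧
      x = Quotient.mk (MulAction.orbitRel (siegelDeltaRat L e dV hdV dW hdW) (ratH L e dV hdV dW hdW))
        ⟨Ψ (UnitaryGroup.toAdelic (Fp L) L (IsCMField.complexConj L) (2 + 2) ((StdForm.antidiagonal (2 + 2)).over L)
            (weylXi L ((IsCMField.complexConj L : L ≃ₐ[Fp L] L) : L →+* L) *
              (klingenLevi L ((IsCMField.complexConj L : L ≃ₐ[Fp L] L) : L →+* L) (complexConj_ringHom_apply_apply L) 1 g * n))),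
          transport_toAdelic_mem_ratH hΨ ha hSA hSAi hXY hYX _⟩ := by
  obtain ⟨q, hq, γ, hγ, rfl⟩ := (mem_compl_cellOne_iff hΨ ha hSA hSAi hXY hYX C₁ hC₁ x).1 hx
  obtain ⟨a', g, n, hn, -, -, hqmn⟩ := exists_klingenLevi_mul_eq (complexConj_ringHom_apply_apply L) hq
  refine ⟨g, n, hn, ?_⟩
  have hγ' : γ = ⟨Ψ (UnitaryGroup.toAdelic (Fp L) L (IsCMField.complexConj L) (2 + 2) ((StdForm.antidiagonal (2 + 2)).over L)
      (weylXi L ((IsCMField.complexConj L : L ≃ₐ[Fp L] L) : L →+* L) * q)), transport_toAdelic_mem_ratH hΨ ha hSA hSAi hXY hYX _⟩ := Subtype.ext hγ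
  rw [hγ']
  refine (mk_transport_eq_mk_transport_iff hΨ ha hSA hSAi hYX _ _ _ _).2 ?_
  rw [hqmn]
  -- `(ξ m(1,g) n) (ξ m(a,g) n)⁻¹ = ξ m(a⁻¹, 1) ξ⁻¹ ∈ P`
  have key : weylXi L ((IsCMField.complexConj L : L ≃ₐ[Fp L] L) : L →+* L) *
        (klingenLevi L ((IsCMField.complexConj L : L ≃ₐ[Fp L] L) : L →+* L) (complexConj_ringHom_apply_apply L) 1 g * n) *
      (weylXi L ((IsCMField.complexConj L : L ≃ₐ[Fp L] L) : L →+* L) *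
        (klingenLevi L ((IsCMField.complexConj L : L ≃ₐ[Fp L] L) : L →+* L) (complexConj_ringHom_apply_apply L) a' g * n))⁻¹ =
      weylXi L ((IsCMField.complexConj L : L ≃ₐ[Fp L] L) : L →+* L) *
        (klingenLevi L ((IsCMField.complexConj L : L ≃ₐ[Fp L] L) : L →+* L) (complexConj_ringHom_apply_apply L) a' 1)⁻¹ *
        (weylXi L ((IsCMField.complexConj L : L ≃ₐ[Fp L] L) : L →+* L))⁻¹ := by
    have hsplit : klingenLevi L ((IsCMField.complexConj L : L ≃ₐ[Fp L] L) : L →+* L) (complexConj_ringHom_apply_apply L) a' g =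
        klingenLevi L ((IsCMField.complexConj L : L ≃ₐ[Fp L] L) : L →+* L) (complexConj_ringHom_apply_apply L) a' 1 *
          klingenLevi L ((IsCMField.complexConj L : L ≃ₐ[Fp L] L) : L →+* L) (complexConj_ringHom_apply_apply L) 1 g := by
      rw [klingenLevi_mul, mul_one, one_mul]
    rw [hsplit]
    group
  rw [key, klingenLevi_inv, inv_one]
  exact weylXi_conj_klingenLevi_one_mem_siegelFour _ _

include hΨ ha hSA hSAi hXY hYX in
/-- **THE ORBIT INVARIANT**: `⟦Ψ(ξ m_Q(1,g′₁) n₁)⟧ = ⟦Ψ(ξ m_Q(1,g′₂) n₂)⟧ ⟹ (g′₂ g′₁⁻¹)₁₀ = 0` (`n₁, n₂ ∈ N_Q(L⁺)`) — two classes of the `ξ`-cell in the same `N_Q(L⁺)`-orbit have Levi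
parts in the same coset of E1's Borel `B₂ ≤ U(J₂)` (★ F4-3a `weylXi_conj_klingenLevi_mul_nKlingen_mem_siegelFour_iff`; `N_Q ⊲ Q` ★ F4-1e).
[cite: MoeglinWaldspurger1995, II.1.7] [cite: Xiong2013, §7 Lemma 7.1] [cite: Casselman1980, §3] -/
theorem apply_one_zero_eq_zero_of_mk_eq_mk {g₁ g₂ : unitaryGroupOfForm ((IsCMField.complexConj L : L ≃ₐ[Fp L] L) : L →+* L) ((StdForm.antidiagonal 2).over L)}
    {n₁ n₂ : unitaryGroupOfForm ((IsCMField.complexConj L : L ≃ₐ[Fp L] L) : L →+* L) ((StdForm.antidiagonal 4).over L)}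
    (hn₁ : n₁ ∈ klingenUnip L ((IsCMField.complexConj L : L ≃ₐ[Fp L] L) : L →+* L) (complexConj_ringHom_apply_apply L))
    (hn₂ : n₂ ∈ klingenUnip L ((IsCMField.complexConj L : L ≃ₐ[Fp L] L) : L →+* L) (complexConj_ringHom_apply_apply L))
    (h : (Quotient.mk (MulAction.orbitRel (siegelDeltaRat L e dV hdV dW hdW) (ratH L e dV hdV dW hdW))
        ⟨Ψ (UnitaryGroup.toAdelic (Fp L) L (IsCMField.complexConj L) (2 + 2) ((StdForm.antidiagonal (2 + 2)).over L)
            (weylXi L ((IsCMField.complexConj L : L ≃ₐ[Fp L] L) : L →+* L) *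
              (klingenLevi L ((IsCMField.complexConj L : L ≃ₐ[Fp L] L) : L →+* L) (complexConj_ringHom_apply_apply L) 1 g₁ * n₁))),
          transport_toAdelic_mem_ratH hΨ ha hSA hSAi hXY hYX _⟩ : SiegelDeltaQuot L e dV hdV dW hdW) =
      Quotient.mk (MulAction.orbitRel (siegelDeltaRat L e dV hdV dW hdW) (ratH L e dV hdV dW hdW))
        ⟨Ψ (UnitaryGroup.toAdelic (Fp L) L (IsCMField.complexConj L) (2 + 2) ((StdForm.antidiagonal (2 + 2)).over L)
            (weylXi L ((IsCMField.complexConj L : L ≃ₐ[Fp L] L) : L →+* L) *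
              (klingenLevi L ((IsCMField.complexConj L : L ≃ₐ[Fp L] L) : L →+* L) (complexConj_ringHom_apply_apply L) 1 g₂ * n₂))),
          transport_toAdelic_mem_ratH hΨ ha hSA hSAi hXY hYX _⟩) :
    (((g₂ * g₁⁻¹ : unitaryGroupOfForm ((IsCMField.complexConj L : L ≃ₐ[Fp L] L) : L →+* L) ((StdForm.antidiagonal 2).over L)) : GL (Fin 2) L) :
      Matrix (Fin 2) (Fin 2) L) 1 0 = 0 := by
  rw [mk_transport_eq_mk_transport_iff hΨ ha hSA hSAi hYX] at h
  -- `(ξ m₂ n₂)(ξ m₁ n₁)⁻¹ = ξ · m(1, g₂g₁⁻¹) · (m₁ (n₂ n₁⁻¹) m₁⁻¹) · ξ⁻¹` with the middle conjugate in `N_Q`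
  have hn' : klingenLevi L ((IsCMField.complexConj L : L ≃ₐ[Fp L] L) : L →+* L) (complexConj_ringHom_apply_apply L) 1 g₁ * (n₂ * n₁⁻¹) *
      (klingenLevi L ((IsCMField.complexConj L : L ≃ₐ[Fp L] L) : L →+* L) (complexConj_ringHom_apply_apply L) 1 g₁)⁻¹ ∈
      klingenUnip L ((IsCMField.complexConj L : L ≃ₐ[Fp L] L) : L →+* L) (complexConj_ringHom_apply_apply L) :=
    conj_mem_klingenUnip _ (klingenLevi_mem_klingen _ 1 g₁) ((klingenUnip L _ _).mul_mem hn₂ ((klingenUnip L _ _).inv_mem hn₁))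
  obtain ⟨y, hy, z, t, hyzt⟩ := hn'
  have key : weylXi L ((IsCMField.complexConj L : L ≃ₐ[Fp L] L) : L →+* L) *
        (klingenLevi L ((IsCMField.complexConj L : L ≃ₐ[Fp L] L) : L →+* L) (complexConj_ringHom_apply_apply L) 1 g₂ * n₂) *
      (weylXi L ((IsCMField.complexConj L : L ≃ₐ[Fp L] L) : L →+* L) *
        (klingenLevi L ((IsCMField.complexConj L : L ≃ₐ[Fp L] L) : L →+* L) (complexConj_ringHom_apply_apply L) 1 g₁ * n₁))⁻¹ =
      weylXi L ((IsCMField.complexConj L : L ≃ₐ[Fp L] L) : L →+* L) *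
        (klingenLevi L ((IsCMField.complexConj L : L ≃ₐ[Fp L] L) : L →+* L) (complexConj_ringHom_apply_apply L) 1 (g₂ * g₁⁻¹) *
          nKlingen L ((IsCMField.complexConj L : L ≃ₐ[Fp L] L) : L →+* L) (complexConj_ringHom_apply_apply L) y hy z t) *
        (weylXi L ((IsCMField.complexConj L : L ≃ₐ[Fp L] L) : L →+* L))⁻¹ := by
    rw [← hyzt]
    have hsplit : klingenLevi L ((IsCMField.complexConj L : L ≃ₐ[Fp L] L) : L →+* L) (complexConj_ringHom_apply_apply L) 1 (g₂ * g₁⁻¹) =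
        klingenLevi L ((IsCMField.complexConj L : L ≃ₐ[Fp L] L) : L →+* L) (complexConj_ringHom_apply_apply L) 1 g₂ *
          (klingenLevi L ((IsCMField.complexConj L : L ≃ₐ[Fp L] L) : L →+* L) (complexConj_ringHom_apply_apply L) 1 g₁)⁻¹ := by
      rw [klingenLevi_inv, inv_one, klingenLevi_mul, mul_one]
    rw [hsplit]
    group
  rw [key, weylXi_conj_klingenLevi_mul_nKlingen_mem_siegelFour_iff] at h
  exact h.1

include hΨ ha hSA hSAi hXY hYX in
/-- **… AND CONVERSELY**: `(g′₂ g′₁⁻¹)₁₀ = 0 ⟹ ⟦Ψ(ξ m_Q(1,g′₂))⟧ = ⟦Ψ(ξ m_Q(1,g′₁))⟧` (`ξ m_Q(1, g′₂g′₁⁻¹) ξ⁻¹ ∈ P(L⁺)`, ★ F4-3a), so the orbits of `⟦Ψ(ξ m_Q(1,g′))⟧` depend only on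
the Borel coset `B₂ g′` — the `ξ`-cell's orbits are indexed by `B₂(L⁺)\U(J₂)(L⁺)` (E1's coset space, by name in F5). [cite: MoeglinWaldspurger1995, II.1.7] [cite: Xiong2013, §7 Lemma 7.1] -/
theorem mk_weylXi_klingenLevi_eq_of_apply_one_zero {g₁ g₂ : unitaryGroupOfForm ((IsCMField.complexConj L : L ≃ₐ[Fp L] L) : L →+* L) ((StdForm.antidiagonal 2).over L)}
    (h10 : (((g₂ * g₁⁻¹ : unitaryGroupOfForm ((IsCMField.complexConj L : L ≃ₐ[Fp L] L) : L →+* L) ((StdForm.antidiagonal 2).over L)) : GL (Fin 2) L) :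
      Matrix (Fin 2) (Fin 2) L) 1 0 = 0) :
    (Quotient.mk (MulAction.orbitRel (siegelDeltaRat L e dV hdV dW hdW) (ratH L e dV hdV dW hdW))
        ⟨Ψ (UnitaryGroup.toAdelic (Fp L) L (IsCMField.complexConj L) (2 + 2) ((StdForm.antidiagonal (2 + 2)).over L)
            (weylXi L ((IsCMField.complexConj L : L ≃ₐ[Fp L] L) : L →+* L) *
              klingenLevi L ((IsCMField.complexConj L : L ≃ₐ[Fp L] L) : L →+* L) (complexConj_ringHom_apply_apply L) 1 g₂)),
          transport_toAdelic_mem_ratH hΨ ha hSA hSAi hXY hYX _⟩ : SiegelDeltaQuot L e dV hdV dW hdW) =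
      Quotient.mk (MulAction.orbitRel (siegelDeltaRat L e dV hdV dW hdW) (ratH L e dV hdV dW hdW))
        ⟨Ψ (UnitaryGroup.toAdelic (Fp L) L (IsCMField.complexConj L) (2 + 2) ((StdForm.antidiagonal (2 + 2)).over L)
            (weylXi L ((IsCMField.complexConj L : L ≃ₐ[Fp L] L) : L →+* L) *
              klingenLevi L ((IsCMField.complexConj L : L ≃ₐ[Fp L] L) : L →+* L) (complexConj_ringHom_apply_apply L) 1 g₁)),
          transport_toAdelic_mem_ratH hΨ ha hSA hSAi hXY hYX _⟩ := by
  rw [mk_transport_eq_mk_transport_iff hΨ ha hSA hSAi hYX]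
  -- `(ξ m₁)(ξ m₂)⁻¹ = ξ m(1, g₁ g₂⁻¹) ξ⁻¹`, and `(g₁g₂⁻¹)₁₀ = 0` too (`B₂` is a group)
  have key : weylXi L ((IsCMField.complexConj L : L ≃ₐ[Fp L] L) : L →+* L) *
        klingenLevi L ((IsCMField.complexConj L : L ≃ₐ[Fp L] L) : L →+* L) (complexConj_ringHom_apply_apply L) 1 g₁ *
      (weylXi L ((IsCMField.complexConj L : L ≃ₐ[Fp L] L) : L →+* L) *
        klingenLevi L ((IsCMField.complexConj L : L ≃ₐ[Fp L] L) : L →+* L) (complexConj_ringHom_apply_apply L) 1 g₂)⁻¹ =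
      weylXi L ((IsCMField.complexConj L : L ≃ₐ[Fp L] L) : L →+* L) *
        klingenLevi L ((IsCMField.complexConj L : L ≃ₐ[Fp L] L) : L →+* L) (complexConj_ringHom_apply_apply L) 1 (g₁ * g₂⁻¹) *
        (weylXi L ((IsCMField.complexConj L : L ≃ₐ[Fp L] L) : L →+* L))⁻¹ := by
    have hsplit : klingenLevi L ((IsCMField.complexConj L : L ≃ₐ[Fp L] L) : L →+* L) (complexConj_ringHom_apply_apply L) 1 (g₁ * g₂⁻¹) =
        klingenLevi L ((IsCMField.complexConj L : L ≃ₐ[Fp L] L) : L →+* L) (complexConj_ringHom_apply_apply L) 1 g₁ *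
          (klingenLevi L ((IsCMField.complexConj L : L ≃ₐ[Fp L] L) : L →+* L) (complexConj_ringHom_apply_apply L) 1 g₂)⁻¹ := by
      rw [klingenLevi_inv, inv_one, klingenLevi_mul, mul_one]
    rw [hsplit]
    group
  rw [key, weylXi_conj_klingenLevi_mem_siegelFour_iff]
  -- `(g₁ g₂⁻¹)₁₀ = 0` from `(g₂ g₁⁻¹)₁₀ = 0`: `g₁ g₂⁻¹ = (g₂ g₁⁻¹)⁻¹` and the `(1,0)` entry of the inverse of a `B₂`-element vanishes
  have hinv : (g₁ * g₂⁻¹ : unitaryGroupOfForm ((IsCMField.complexConj L : L ≃ₐ[Fp L] L) : L →+* L) ((StdForm.antidiagonal 2).over L)) = (g₂ * g₁⁻¹)⁻¹ := by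
    rw [mul_inv_rev, inv_inv]
  set b := (g₂ * g₁⁻¹ : unitaryGroupOfForm ((IsCMField.complexConj L : L ≃ₐ[Fp L] L) : L →+* L) ((StdForm.antidiagonal 2).over L)) with hb
  rw [hinv]
  have hprod : (((b⁻¹ : unitaryGroupOfForm ((IsCMField.complexConj L : L ≃ₐ[Fp L] L) : L →+* L) ((StdForm.antidiagonal 2).over L)) : GL (Fin 2) L) :
      Matrix (Fin 2) (Fin 2) L) * ((b : GL (Fin 2) L) : Matrix (Fin 2) (Fin 2) L) = 1 := by
    rw [Subgroup.coe_inv, ← Units.val_mul, inv_mul_cancel, Units.val_one]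
  -- entry `(1,0)` of `b⁻¹ b = 1`: `(b⁻¹)₁₀ b₀₀ = 0`, and `b₀₀` is a unit since `det b = b₀₀ b₁₁` is
  have e10 := congrFun (congrFun hprod 1) 0
  simp only [Matrix.mul_apply, Fin.sum_univ_two, h10, Matrix.one_apply_ne (show (1 : Fin 2) ≠ 0 by decide), mul_zero, add_zero] at e10
  have hunit : IsUnit (((b : GL (Fin 2) L) : Matrix (Fin 2) (Fin 2) L) 0 0) := by
    have hdet : IsUnit ((b : GL (Fin 2) L) : Matrix (Fin 2) (Fin 2) L).det := Matrix.isUnits_det_units (b : GL (Fin 2) L)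
    rw [Matrix.det_fin_two, h10, mul_zero, sub_zero] at hdet
    exact isUnit_of_mul_isUnit_left hdet
  exact (hunit.mul_left_eq_zero).1 e10

/-! ## §3 The stabilisers: `Stab(⟦Ψ(ξ m)⟧) = Ψ(m⁻¹ u₊(L⁺) m)` -/

include hΨ ha hSA hSAi hYX in
/-- **THE STABILISER LAW OF A `ξ`-CELL REPRESENTATIVE**: for `m ∈ Q(L⁺)` and `n ∈ N_Q(L⁺)`,
`Ψ(ξ m) · Ψ(n) · Ψ(ξ m)⁻¹ ∈ P_Δ(𝔸) ⟺ ∃ z, m n m⁻¹ = u_{e₁+e₂}(z)` — i.e. `Stab(⟦Ψ(ξ m)⟧) ∩ N_Q(L⁺) = Ψ(m⁻¹ u₊(L⁺) m)` (with ★ F4-2b `mk_mul_coe_eq_mk_iff_isSiegelDelta` and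
§1 this is the membership law of the `Γ'` that ★ F4-2b's regrouping takes for the orbit of `⟦Ψ(ξ m)⟧`; ★ F4-1e `N_Q ⊲ Q`, ★ F4-0 §3 `N_Q ∩ ξ⁻¹Pξ = u₊`).
[cite: Xiong2013, §7 Lemma 7.1] [cite: GanTakeda2011SiegelWeil, §7.2 p. 23] [cite: MoeglinWaldspurger1995, II.1.7] -/
theorem isSiegelDelta_conj_transport_iff_exists_uPlus {m n : unitaryGroupOfForm ((IsCMField.complexConj L : L ≃ₐ[Fp L] L) : L →+* L) ((StdForm.antidiagonal 4).over L)}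
    (hm : m ∈ klingen L ((IsCMField.complexConj L : L ≃ₐ[Fp L] L) : L →+* L))
    (hn : n ∈ klingenUnip L ((IsCMField.complexConj L : L ≃ₐ[Fp L] L) : L →+* L) (complexConj_ringHom_apply_apply L)) :
    IsSiegelDelta L e dV hdV dW hdW
        (Ψ (UnitaryGroup.toAdelic (Fp L) L (IsCMField.complexConj L) (2 + 2) ((StdForm.antidiagonal (2 + 2)).over L)
            (weylXi L ((IsCMField.complexConj L : L ≃ₐ[Fp L] L) : L →+* L) * m)) *
          Ψ (UnitaryGroup.toAdelic (Fp L) L (IsCMField.complexConj L) (2 + 2) ((StdForm.antidiagonal (2 + 2)).over L) n) *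
          (Ψ (UnitaryGroup.toAdelic (Fp L) L (IsCMField.complexConj L) (2 + 2) ((StdForm.antidiagonal (2 + 2)).over L)
            (weylXi L ((IsCMField.complexConj L : L ≃ₐ[Fp L] L) : L →+* L) * m)))⁻¹) ↔
      ∃ z : L, m * n * m⁻¹ = uPlus L ((IsCMField.complexConj L : L ≃ₐ[Fp L] L) : L →+* L) (complexConj_ringHom_apply_apply L) z := by
  obtain ⟨y, hy, z, t, hyzt⟩ := conj_mem_klingenUnip (complexConj_ringHom_apply_apply L) hm hn
  have hrew : Ψ (UnitaryGroup.toAdelic (Fp L) L (IsCMField.complexConj L) (2 + 2) ((StdForm.antidiagonal (2 + 2)).over L)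
          (weylXi L ((IsCMField.complexConj L : L ≃ₐ[Fp L] L) : L →+* L) * m)) *
        Ψ (UnitaryGroup.toAdelic (Fp L) L (IsCMField.complexConj L) (2 + 2) ((StdForm.antidiagonal (2 + 2)).over L) n) *
        (Ψ (UnitaryGroup.toAdelic (Fp L) L (IsCMField.complexConj L) (2 + 2) ((StdForm.antidiagonal (2 + 2)).over L)
          (weylXi L ((IsCMField.complexConj L : L ≃ₐ[Fp L] L) : L →+* L) * m)))⁻¹ =
      Ψ (UnitaryGroup.toAdelic (Fp L) L (IsCMField.complexConj L) (2 + 2) ((StdForm.antidiagonal (2 + 2)).over L)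
        (weylXi L ((IsCMField.complexConj L : L ≃ₐ[Fp L] L) : L →+* L) * (m * n * m⁻¹) *
          (weylXi L ((IsCMField.complexConj L : L ≃ₐ[Fp L] L) : L →+* L))⁻¹)) := by
    rw [← transport_toAdelic_mul, ← transport_toAdelic_inv, ← transport_toAdelic_mul]
    congr 2
    group
  rw [hrew, isSiegelDelta_transport_toAdelic_iff hΨ ha hSA hSAi hYX, hyzt, weylXi_conj_nKlingen_mem_siegelFour_iff_eq_uPlus]
  constructor
  · intro h; exact ⟨z, h⟩
  · rintro ⟨z', hz'⟩
    have h' := hz'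
    rw [uPlus_eq_nKlingen] at h'
    obtain ⟨-, hzz', -⟩ := nKlingen_injective (complexConj_ringHom_apply_apply L) h'
    subst hzz'
    exact hz'

end Transport

end Summit.HodgeConjecture.HodgeConjecture.Cruxes.HLiu418.K2LiuKlingenCellXiOrbits

end
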